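import Literature.NumberTheory.Automorphic.HeckeGelfandTrick
import HarnessLib

/-!
# Adjoint Hecke operators for an invariant bilinear pairing: `B([KgK] x, y) = B(x, [Kg⁻¹K] y)` on fixed vectors

Topic `NumberTheory/Automorphic`; namespace `Literature.NumberTheory.Automorphic`.  Theorems only — no definition, no
named fact, no instance, no `sorry`; imports = ★ `HeckeGelfandTrick` ⊇ ★ `HeckeAlgebra` (`heckeOperator ρ K g = ∑_{yK ⊆ KgK} ρ(y)`,
`Representation.fixedPoints`) + Mathlib.

This is the BILINEAR (algebraic, any commutative coefficient ring `k`, any two representations in duality) twin of the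
tree's unitary statement ★ `inner_heckeOperator_apply_eq_inner_heckeOperator_inv` (`HeckeOperatorAdjoint.lean`,
Deitmar–Echterhoff (2014) Prop. 6.2.1 / Diamond–Shurman (2005) Prop. 5.5.2 (b)): for representations `ρ₁`, `ρ₂` of a
group `G` on `k`-modules `V₁`, `V₂`, a `G`-INVARIANT pairing `B : V₁ → V₂ → W` (`B (ρ₁ g x) (ρ₂ g y) = B x y`), a subgroup
`K` and `g ∈ G` whose double cosets `KgK`, `Kg⁻¹K` contain the same finite number of left cosets (automatic for `K`
compact open in a unimodular locally compact group: ★ `ncard_orbit_inv_eq_of_isCompact_isOpen`), and FIXED vectors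
`x ∈ V₁^K`, `y ∈ V₂^K`:

* `invariantPairing_heckeOperator_apply_left`  — `B ([KgK] x) y = #(KgK/K) • B (ρ₁ g x) y`;
* `invariantPairing_heckeOperator_apply_right` — `B x ([KgK] y) = #(KgK/K) • B x (ρ₂ g y)`;
* **`invariantPairing_heckeOperator_apply_eq_heckeOperator_inv`** — `B ([KgK] x) y = B x ([Kg⁻¹K] y)`;
* `invariantPairing_heckeOperator_apply_comm_of_inv_mem` — if `g⁻¹ ∈ KgK` then `B ([KgK] x) y = B x ([KgK] y)`.

The tree already has the `ℂ`-valued one-representation special case of the first bullet as ★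
`pairing_heckeOperator_apply_left` (`AutomorphicRepsGLSatakeUnitaryProofs.lean`, a form `B : V → V → ℂ` on a stable
subspace); here `k`, the two representations and the value module `W` are arbitrary, which is what an `ℓ`-adic Weil
pairing `V_ℓ × V_ℓ^∨ → ℚ_ℓ(1)` needs.  The classical instance is the Petersson/cup-product adjointness of Hecke correspondences `[ΓαΓ]^* = [Γα′Γ]`
(Diamond–Shurman Prop. 5.5.2; Shimura (1971) (3.4.5)); the `ℓ`-adic instance (Weil pairing on `H¹_ét` of a tower of
Shimura curves, `[KgK]^† = [Kg⁻¹K]` for the Rosati involution of a Hecke-compatible polarisation) is the intended consumer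
(cell hodgecm-mathlib, d6 card §0⁸ (IV) `SocketRosZ`, road (P) leg (T1) of census 713b7d73).  HC_CM is proved only modulo
the 7 printed citations until rung 0 closes; this file moves no book.

## References
* [DiamondShurman2005] F. Diamond, J. Shurman, *A First Course in Modular Forms*, GTM 228 (2005), §5.5, Lemma 5.5.1 and
  Prop. 5.5.2.
* [DeitmarEchterhoff2014] A. Deitmar, S. Echterhoff, *Principles of Harmonic Analysis*, 2nd ed. (2014), Prop. 6.2.1 with
  Prop. 2.6.2.
* [Shimura1971] G. Shimura, *Introduction to the Arithmetic Theory of Automorphic Functions* (1971), §3.4, Prop. 3.1 and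
  formula (3.4.5).
-/

set_option autoImplicit false

open MulAction

namespace Literature.NumberTheory.Automorphic

section Pairing

variable {k G V₁ V₂ W : Type*} [CommRing k] [Group G] [AddCommGroup V₁] [Module k V₁] [AddCommGroup V₂] [Module k V₂]
  [AddCommGroup W] [Module k W]
variable (ρ₁ : Representation k G V₁) (ρ₂ : Representation k G V₂) (B : V₁ →ₗ[k] V₂ →ₗ[k] W)

/-- A representative of a point of the `K`-orbit of `gK` in `G ⧸ K` has the form `k g k'` with `k, k' ∈ K`
(Shimura (1971), Prop. 3.1; the tree's `exists_out_eq_mul_mul`, restated here to keep the imports minimal). [folklore] -/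
private theorem exists_out_eq_mul_mul' {K : Subgroup G} {g : G} {y : G ⧸ K} (hy : y ∈ orbit K (g : G ⧸ K)) :
    ∃ a ∈ K, ∃ a' ∈ K, y.out = a * g * a' := by
  obtain ⟨a, rfl⟩ := mem_orbit_iff.1 hy
  obtain ⟨h, H⟩ := QuotientGroup.mk_out_eq_mul K ((a : G) * g)
  exact ⟨a, a.2, h, h.2, H⟩

/-- Invariance lets a group element move across the pairing as its inverse: `B (ρ₁ g x) y = B x (ρ₂ g⁻¹ y)`
(plumbing for the two theorems below). [folklore] -/
private theorem invariantPairing_apply_map_left (hB : ∀ (g : G) (x : V₁) (y : V₂), B (ρ₁ g x) (ρ₂ g y) = B x y)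
    (g : G) (x : V₁) (y : V₂) : B (ρ₁ g x) y = B x (ρ₂ g⁻¹ y) := by
  have e : ρ₂ g (ρ₂ g⁻¹ y) = y := by
    rw [← Module.End.mul_apply, ← map_mul, mul_inv_cancel, map_one, Module.End.one_apply]
  conv_lhs => rw [← e]
  rw [hB]

/-- **Matrix coefficients of a Hecke operator against fixed vectors, first variable.**  For a `G`-invariant pairing
`B`, `x ∈ V₁^K`, `y ∈ V₂^K` and `KgK/K` finite: `B ([KgK] x) y = #(KgK/K) • B (ρ₁ g x) y` — each representative is
`yᵢ = a g a′` with `a, a′ ∈ K`, and `B (ρ₁ a (ρ₁ g x)) y = B (ρ₁ g x) (ρ₂ a⁻¹ y) = B (ρ₁ g x) y`.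
[cite: DeitmarEchterhoff2014, Thm. 11.2.4 (proof)] [cite: Shimura1971, Prop. 3.1] -/
theorem invariantPairing_heckeOperator_apply_left (hB : ∀ (g : G) (x : V₁) (y : V₂), B (ρ₁ g x) (ρ₂ g y) = B x y)
    (K : Subgroup G) (g : G) (hfin : (orbit K (g : G ⧸ K)).Finite) {x : V₁} {y : V₂}
    (hx : x ∈ ρ₁.fixedPoints K) (hy : y ∈ ρ₂.fixedPoints K) :
    B (heckeOperator ρ₁ K g x) y = hfin.toFinset.card • B (ρ₁ g x) y := by
  classical
  rw [heckeOperator, finsum_mem_eq_finite_toFinset_sum _ hfin, LinearMap.sum_apply, map_sum, LinearMap.sum_apply,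
    ← Finset.sum_const]
  refine Finset.sum_congr rfl fun z hz => ?_
  obtain ⟨a, ha, a', ha', H⟩ := exists_out_eq_mul_mul' ((Set.Finite.mem_toFinset hfin).1 hz)
  rw [Representation.mem_fixedPoints] at hx hy
  rw [H, map_mul, map_mul, Module.End.mul_apply, Module.End.mul_apply, hx a' ha',
    invariantPairing_apply_map_left ρ₁ ρ₂ B hB a, hy a⁻¹ (K.inv_mem ha)]

/-- **Matrix coefficients of a Hecke operator against fixed vectors, second variable**: `B x ([KgK] y) =
#(KgK/K) • B x (ρ₂ g y)` for `x ∈ V₁^K`, `y ∈ V₂^K`. [cite: DeitmarEchterhoff2014, Thm. 11.2.4 (proof)] -/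
theorem invariantPairing_heckeOperator_apply_right (hB : ∀ (g : G) (x : V₁) (y : V₂), B (ρ₁ g x) (ρ₂ g y) = B x y)
    (K : Subgroup G) (g : G) (hfin : (orbit K (g : G ⧸ K)).Finite) {x : V₁} {y : V₂}
    (hx : x ∈ ρ₁.fixedPoints K) (hy : y ∈ ρ₂.fixedPoints K) :
    B x (heckeOperator ρ₂ K g y) = hfin.toFinset.card • B x (ρ₂ g y) := by
  -- swap the variables: `B.flip` is invariant for `(ρ₂, ρ₁)`
  have hB' : ∀ (g : G) (y : V₂) (x : V₁), B.flip (ρ₂ g y) (ρ₁ g x) = B.flip y x := fun g y x => hB g x y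
  simpa only [LinearMap.flip_apply] using invariantPairing_heckeOperator_apply_left ρ₂ ρ₁ B.flip hB' K g hfin hy hx

/-- **The Hecke operators of `KgK` and `Kg⁻¹K` are adjoint for an invariant pairing, on fixed vectors.**  Let `B` be a
`G`-invariant pairing between representations `ρ₁`, `ρ₂`, `K ≤ G`, and `g ∈ G` with `KgK/K`, `Kg⁻¹K/K` finite of the
same cardinality (for `K` compact open in a unimodular group: ★ `ncard_orbit_inv_eq_of_isCompact_isOpen`).  Then for
`x ∈ V₁^K`, `y ∈ V₂^K`: `B ([KgK] x) y = B x ([Kg⁻¹K] y)`.  Proof: both sides equal `#(KgK/K) • B (ρ₁ g x) y =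
#(Kg⁻¹K/K) • B x (ρ₂ g⁻¹ y)`.  This is Deitmar–Echterhoff Prop. 6.2.1 (`π(f)^* = π(f^*)`, `f^*(x) = f(x⁻¹)` for `G`
unimodular) at `f = 𝟙_{KgK}`, and Diamond–Shurman Prop. 5.5.2 (b) `[ΓαΓ]^* = [Γα′Γ]` for the Petersson (here: any
invariant) pairing. [cite: DeitmarEchterhoff2014, Prop. 6.2.1] [cite: DiamondShurman2005, Prop. 5.5.2] -/
theorem invariantPairing_heckeOperator_apply_eq_heckeOperator_inv
    (hB : ∀ (g : G) (x : V₁) (y : V₂), B (ρ₁ g x) (ρ₂ g y) = B x y) (K : Subgroup G) (g : G)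
    (hfin : (orbit K (g : G ⧸ K)).Finite) (hfin' : (orbit K ((g⁻¹ : G) : G ⧸ K)).Finite)
    (hdeg : (orbit K ((g⁻¹ : G) : G ⧸ K)).ncard = (orbit K (g : G ⧸ K)).ncard) {x : V₁} {y : V₂}
    (hx : x ∈ ρ₁.fixedPoints K) (hy : y ∈ ρ₂.fixedPoints K) :
    B (heckeOperator ρ₁ K g x) y = B x (heckeOperator ρ₂ K g⁻¹ y) := by
  rw [invariantPairing_heckeOperator_apply_left ρ₁ ρ₂ B hB K g hfin hx hy,
    invariantPairing_heckeOperator_apply_right ρ₁ ρ₂ B hB K g⁻¹ hfin' hx hy, ← Set.ncard_eq_toFinset_card _ hfin,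
    ← Set.ncard_eq_toFinset_card _ hfin', hdeg, invariantPairing_apply_map_left ρ₁ ρ₂ B hB g x y]

/-- **Self-adjoint case.**  If moreover `g⁻¹ ∈ KgK` (so `Kg⁻¹K = KgK`), then `[KgK]` is self-adjoint for `B` on fixed
vectors: `B ([KgK] x) y = B x ([KgK] y)`. [cite: DiamondShurman2005, Prop. 5.5.2] [cite: DeitmarEchterhoff2014, Thm. 11.2.4] -/
theorem invariantPairing_heckeOperator_apply_comm_of_inv_mem
    (hB : ∀ (g : G) (x : V₁) (y : V₂), B (ρ₁ g x) (ρ₂ g y) = B x y) (K : Subgroup G) (g : G)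
    (hfin : (orbit K (g : G ⧸ K)).Finite) (hg : g⁻¹ ∈ DoubleCoset.doubleCoset g (K : Set G) K) {x : V₁} {y : V₂}
    (hx : x ∈ ρ₁.fixedPoints K) (hy : y ∈ ρ₂.fixedPoints K) :
    B (heckeOperator ρ₁ K g x) y = B x (heckeOperator ρ₂ K g y) := by
  obtain ⟨a, ha, b, hb, hab⟩ := DoubleCoset.mem_doubleCoset.1 hg
  have horb : orbit K ((g⁻¹ : G) : G ⧸ K) = orbit K (g : G ⧸ K) := by
    rw [hab]
    exact orbit_mk_mul_mul_eq K ha hb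
  conv_rhs => rw [← heckeOperator_eq_of_orbit_eq ρ₂ K horb]
  exact invariantPairing_heckeOperator_apply_eq_heckeOperator_inv ρ₁ ρ₂ B hB K g hfin (by rw [horb]; exact hfin)
    (by rw [horb]) hx hy

end Pairing

/-! ### The bilinear-form spelling (`ρ₁ = ρ₂ = ρ`, `B : LinearMap.BilinForm k V`) -/

section BilinForm

variable {k G V : Type*} [CommRing k] [Group G] [AddCommGroup V] [Module k V]
  (ρ : Representation k G V) (B : LinearMap.BilinForm k V)

/-- **`B ([KgK] x) y = B x ([Kg⁻¹K] y)` for a `G`-invariant bilinear form** `B` on one representation `ρ` and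
`x, y ∈ V^K` (`#(KgK/K) = #(Kg⁻¹K/K)` finite) — the form in which the Rosati/Weil-pairing adjointness of Hecke
correspondences is consumed. [cite: DiamondShurman2005, Prop. 5.5.2] [cite: DeitmarEchterhoff2014, Prop. 6.2.1] -/
theorem bilin_heckeOperator_apply_eq_bilin_heckeOperator_inv
    (hB : ∀ (g : G) (x y : V), B (ρ g x) (ρ g y) = B x y) (K : Subgroup G) (g : G)
    (hfin : (orbit K (g : G ⧸ K)).Finite) (hfin' : (orbit K ((g⁻¹ : G) : G ⧸ K)).Finite)
    (hdeg : (orbit K ((g⁻¹ : G) : G ⧸ K)).ncard = (orbit K (g : G ⧸ K)).ncard) {x y : V}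
    (hx : x ∈ ρ.fixedPoints K) (hy : y ∈ ρ.fixedPoints K) :
    B (heckeOperator ρ K g x) y = B x (heckeOperator ρ K g⁻¹ y) :=
  invariantPairing_heckeOperator_apply_eq_heckeOperator_inv ρ ρ B hB K g hfin hfin' hdeg hx hy

/-- Self-adjointness of `[KgK]` for an invariant bilinear form when `g⁻¹ ∈ KgK`. [cite: DiamondShurman2005, Prop. 5.5.2] -/
theorem bilin_heckeOperator_apply_comm_of_inv_mem
    (hB : ∀ (g : G) (x y : V), B (ρ g x) (ρ g y) = B x y) (K : Subgroup G) (g : G)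
    (hfin : (orbit K (g : G ⧸ K)).Finite) (hg : g⁻¹ ∈ DoubleCoset.doubleCoset g (K : Set G) K) {x y : V}
    (hx : x ∈ ρ.fixedPoints K) (hy : y ∈ ρ.fixedPoints K) :
    B (heckeOperator ρ K g x) y = B x (heckeOperator ρ K g y) :=
  invariantPairing_heckeOperator_apply_comm_of_inv_mem ρ ρ B hB K g hfin hg hx hy

end BilinForm

/-! ### Without unimodularity: the cross-multiplied adjointness `#(Kg⁻¹K/K) • B([KgK] x, y) = #(KgK/K) • B(x, [Kg⁻¹K] y)` -/

section NoDegree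

variable {k G V₁ V₂ W : Type*} [CommRing k] [Group G] [AddCommGroup V₁] [Module k V₁] [AddCommGroup V₂] [Module k V₂]
  [AddCommGroup W] [Module k W]
variable (ρ₁ : Representation k G V₁) (ρ₂ : Representation k G V₂) (B : V₁ →ₗ[k] V₂ →ₗ[k] W)

/-- Invariance moves `g` across the pairing as `g⁻¹` (edition-2 copy of the private plumbing lemma above). [folklore] -/
private theorem invariantPairing_apply_map_left' (hB : ∀ (g : G) (x : V₁) (y : V₂), B (ρ₁ g x) (ρ₂ g y) = B x y)
    (g : G) (x : V₁) (y : V₂) : B (ρ₁ g x) y = B x (ρ₂ g⁻¹ y) := by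
  have e : ρ₂ g (ρ₂ g⁻¹ y) = y := by
    rw [← Module.End.mul_apply, ← map_mul, mul_inv_cancel, map_one, Module.End.one_apply]
  conv_lhs => rw [← e]
  rw [hB]

/-- **Adjointness WITHOUT the degree hypothesis** (no unimodularity): for a `G`-invariant pairing `B`, `x ∈ V₁^K`, `y ∈ V₂^K`
and both double cosets finite, `#(Kg⁻¹K/K) • B ([KgK] x) y = #(KgK/K) • B x ([Kg⁻¹K] y)` — both sides equal
`#(KgK/K) · #(Kg⁻¹K/K) · B (ρ₁ g x) y`.  In particular the `B`-adjoint of `[KgK]` is a POSITIVE RATIONAL multiple of `[Kg⁻¹K]`,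
which is all that the Rosati-stability of a Hecke algebra needs; with `#(Kg⁻¹K/K) = #(KgK/K)` (unimodular case) it is the
adjointness `invariantPairing_heckeOperator_apply_eq_heckeOperator_inv`. [cite: DiamondShurman2005, Prop. 5.5.2]
[cite: DeitmarEchterhoff2014, Prop. 6.2.1] -/
theorem invariantPairing_ncard_smul_heckeOperator_apply_eq
    (hB : ∀ (g : G) (x : V₁) (y : V₂), B (ρ₁ g x) (ρ₂ g y) = B x y) (K : Subgroup G) (g : G)
    (hfin : (orbit K (g : G ⧸ K)).Finite) (hfin' : (orbit K ((g⁻¹ : G) : G ⧸ K)).Finite) {x : V₁} {y : V₂}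
    (hx : x ∈ ρ₁.fixedPoints K) (hy : y ∈ ρ₂.fixedPoints K) :
    (orbit K ((g⁻¹ : G) : G ⧸ K)).ncard • B (heckeOperator ρ₁ K g x) y =
      (orbit K (g : G ⧸ K)).ncard • B x (heckeOperator ρ₂ K g⁻¹ y) := by
  rw [invariantPairing_heckeOperator_apply_left ρ₁ ρ₂ B hB K g hfin hx hy,
    invariantPairing_heckeOperator_apply_right ρ₁ ρ₂ B hB K g⁻¹ hfin' hx hy, ← Set.ncard_eq_toFinset_card _ hfin,
    ← Set.ncard_eq_toFinset_card _ hfin', ← invariantPairing_apply_map_left' ρ₁ ρ₂ B hB g x y, smul_smul, smul_smul, mul_comm]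

/-- The bilinear-form spelling of `invariantPairing_ncard_smul_heckeOperator_apply_eq` (`ρ₁ = ρ₂ = ρ`):
`#(Kg⁻¹K/K) • B ([KgK] x) y = #(KgK/K) • B x ([Kg⁻¹K] y)` for a `G`-invariant bilinear form and `x, y ∈ V^K`, no unimodularity
assumed. [cite: DiamondShurman2005, Prop. 5.5.2] -/
theorem bilin_ncard_smul_heckeOperator_apply_eq {V : Type*} [AddCommGroup V] [Module k V] (ρ : Representation k G V)
    (B : LinearMap.BilinForm k V) (hB : ∀ (g : G) (x y : V), B (ρ g x) (ρ g y) = B x y) (K : Subgroup G) (g : G)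
    (hfin : (orbit K (g : G ⧸ K)).Finite) (hfin' : (orbit K ((g⁻¹ : G) : G ⧸ K)).Finite) {x y : V}
    (hx : x ∈ ρ.fixedPoints K) (hy : y ∈ ρ.fixedPoints K) :
    (orbit K ((g⁻¹ : G) : G ⧸ K)).ncard • B (heckeOperator ρ K g x) y =
      (orbit K (g : G ⧸ K)).ncard • B x (heckeOperator ρ K g⁻¹ y) :=
  invariantPairing_ncard_smul_heckeOperator_apply_eq ρ ρ B hB K g hfin hfin' hx hy

/-- Both orbit counts are POSITIVE naturals (the orbit contains `gK`), so the cross-multiplied identity determines the adjoint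
up to the positive rational factor `#(KgK/K) / #(Kg⁻¹K/K)` (Diamond–Shurman Lemma 5.5.1: `ΓαΓ = ⋃ Γβ_j` is a finite NONEMPTY
union). [cite: DiamondShurman2005, Lemma 5.5.1] -/
theorem ncard_orbit_mk_pos (K : Subgroup G) (g : G) (hfin : (orbit K (g : G ⧸ K)).Finite) :
    0 < (orbit K (g : G ⧸ K)).ncard :=
  (Set.ncard_pos hfin).2 ⟨(g : G ⧸ K), mem_orbit_self _⟩

end NoDegree

end Literature.NumberTheory.Automorphic
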